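import Mathlib
import Literature.MathematicalPhysics.QuantumFieldTheory.Luscher2010.TrivializingMaps
import Summits.Ventures.LatticeQCDFlow.TrivializingMaps.TruncationDefect
import Summits.Ventures.LatticeQCDFlow.TrivializingMaps.GaugeCovariance
import Summits.Ventures.LatticeQCDFlow.TrivializingMaps.WilsonPolynomials
import HarnessLib

/-!
# Basis independence of the link Laplacian and of the defect density

HONEST FRAMING: exact (Metropolis-corrected) sampling algorithms for lattice gauge theory; figures of merit are
autocorrelation/cost numbers at stated couplings and volumes; no continuum-physics claim.

Lüscher, CMP 293 (2010) 899, App. A.1 (after (A.2)): sums `∑_a X(T^a) Y(T^a)` over an orthonormal basis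
`tr(T^a T^b) = -½δ^{ab}` of `𝔰𝔲(n)` "do not depend on the choice of basis". We prove the exchange identity
`∑_a q(T_a, T_a) = ∑_b q(T'_b, T'_b)` (`sum_suBasis_eq`) for any `q` that is additive-homogeneous in each
slot along basis expansions, from completeness (`SuBasis.span`, read through the coordinates
`SuBasis.coord`, `sum_coord_smul_eq`) and the symmetry `(T_a)'^b = (T'_b)^a` of the trace form
(`suBasis_coord_comm`). Consequences: the link Laplacian `Δ_B f` of a smooth functional
(`linkLap_suBasis_eq`), the pointwise products `∑_a ∂^a_e g ∂^a_e f` (`sum_linkDeriv_mul_suBasis_eq`) and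
Lüscher's defect density `𝓥` (`luscherV_suBasis_eq`) do not depend on the basis `B`. This is what makes the
constants of the volume law `ExtensiveDefect` uniform in `B`. Reference: M. Lüscher, CMP 293 (2010) 899
[Luscher2010Trivializing, arXiv:0907.5491], App. A.1 eqs. (A.1)–(A.2), §4.2 eq. (4.6).
-/

namespace Summit.Ventures.LatticeQCDFlow.TrivializingMaps

open Literature.MathematicalPhysics.QuantumFieldTheory
open Literature.MathematicalPhysics.QuantumFieldTheory.Luscher2010
open scoped Matrix Matrix.Norms.Frobenius ContDiff

variable {d L n : ℕ}

/-- Symmetry of the trace form in coordinates: the `b`-th `B'`-coordinate of `T_a` is the `a`-th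
`B`-coordinate of `T'_b` (`-2 Re tr(T'_b T_a) = -2 Re tr(T_a T'_b)`).
[cite: Luscher2010Trivializing, App. A.1 eq. (A.2), App. A.3 eq. (A.10)] -/
theorem suBasis_coord_comm (B B' : SuBasis n) (a : B.ι) (b : B'.ι) :
    B'.coord b (B.T a) = B.coord a (B'.T b) := by
  unfold SuBasis.coord
  rw [Matrix.trace_mul_comm]

/-- **Basis exchange.** For `q` additive-homogeneous in its first slot along `B'`-expansions and in its second
slot along `B`-expansions, `∑_a q(T_a, T_a) = ∑_b q(T'_b, T'_b)`: expand the first slot of `T_a` in the basis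
`B'`, exchange the sums, and resum the second slot with `(T_a)'^b = (T'_b)^a` and completeness of `B`.
[cite: Luscher2010Trivializing, App. A.1 (after eq. (A.2))] -/
theorem sum_suBasis_eq (B B' : SuBasis n) (q : Matrix (Fin n) (Fin n) ℂ → Matrix (Fin n) (Fin n) ℂ → ℝ)
    (hq1 : ∀ (c : B'.ι → ℝ) (Y : Matrix (Fin n) (Fin n) ℂ),
      q (∑ b, ((c b : ℝ) : ℂ) • B'.T b) Y = ∑ b, c b * q (B'.T b) Y)
    (hq2 : ∀ (X : Matrix (Fin n) (Fin n) ℂ) (c : B.ι → ℝ),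
      q X (∑ a, ((c a : ℝ) : ℂ) • B.T a) = ∑ a, c a * q X (B.T a)) :
    ∑ a, q (B.T a) (B.T a) = ∑ b, q (B'.T b) (B'.T b) := by
  have hTa : ∀ a, ∑ b, ((B'.coord b (B.T a) : ℝ) : ℂ) • B'.T b = B.T a :=
    fun a => sum_coord_smul_eq B' (B.mem a)
  have hTb : ∀ b, ∑ a, ((B.coord a (B'.T b) : ℝ) : ℂ) • B.T a = B'.T b :=
    fun b => sum_coord_smul_eq B (B'.mem b)
  calc ∑ a, q (B.T a) (B.T a)
      = ∑ a, ∑ b, B'.coord b (B.T a) * q (B'.T b) (B.T a) := by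
        refine Finset.sum_congr rfl fun a _ => ?_
        rw [← hq1 (fun b => B'.coord b (B.T a)) (B.T a), hTa]
    _ = ∑ b, ∑ a, B.coord a (B'.T b) * q (B'.T b) (B.T a) := by
        rw [Finset.sum_comm]
        simp_rw [suBasis_coord_comm]
    _ = ∑ b, q (B'.T b) (B'.T b) := by
        refine Finset.sum_congr rfl fun b _ => ?_
        rw [← hq2 (B'.T b) (fun a => B.coord a (B'.T b)), hTb]

variable [NeZero L]

/-- The pointwise products `∑_a ∂^a_e g · ∂^a_e f` do not depend on the basis.
[cite: Luscher2010Trivializing, App. A.1 (after eq. (A.2)), §4.3 eq. (4.15)] -/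
theorem sum_linkDeriv_mul_suBasis_eq (B B' : SuBasis n) {f g : AmbConfig d L n → ℝ} {W : AmbConfig d L n}
    (hg : DifferentiableAt ℝ g W) (hf : DifferentiableAt ℝ f W) (e : Edge d L) :
    ∑ a, linkDeriv e (B.T a) g W * linkDeriv e (B.T a) f W =
      ∑ b, linkDeriv e (B'.T b) g W * linkDeriv e (B'.T b) f W :=
  sum_suBasis_eq B B' (fun X Y => linkDeriv e X g W * linkDeriv e Y f W)
    (fun c Y => by
      rw [linkDeriv_sum_smul hg e c B'.T, Finset.sum_mul]
      simp_rw [mul_assoc])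
    (fun X c => by
      rw [linkDeriv_sum_smul hf e c B.T, Finset.mul_sum]
      simp_rw [mul_left_comm])

/-- **Lüscher's defect density `𝓥_S f = ∑_{e,a} ∂^a_e S ∂^a_e f` does not depend on the basis** (for
differentiable `S, f`). [cite: Luscher2010Trivializing, §4.3 eq. (4.15), App. A.1] -/
theorem luscherV_suBasis_eq (B B' : SuBasis n) {S f : AmbConfig d L n → ℝ} (hS : Differentiable ℝ S)
    (hf : Differentiable ℝ f) : luscherV B S f = luscherV B' S f := by
  funext W
  unfold luscherV
  exact Finset.sum_congr rfl fun e _ => sum_linkDeriv_mul_suBasis_eq B B' (hS W) (hf W) e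

/-- The iterated derivative `∂^X_e (∑_a c_a ∂^{T_a}_e f) = ∑_a c_a ∂^X_e ∂^{T_a}_e f` for smooth `f`. [folklore] -/
theorem linkDeriv_linkDeriv_sum_smul (B : SuBasis n) {f : AmbConfig d L n → ℝ} (hf : ContDiff ℝ ∞ f)
    (e : Edge d L) (X : Matrix (Fin n) (Fin n) ℂ) (c : B.ι → ℝ) (W : AmbConfig d L n) :
    linkDeriv e X (linkDeriv e (∑ a, ((c a : ℝ) : ℂ) • B.T a) f) W =
      ∑ a, c a * linkDeriv e X (linkDeriv e (B.T a) f) W := by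
  have h : linkDeriv e (∑ a, ((c a : ℝ) : ℂ) • B.T a) f =
      fun W => ∑ a ∈ Finset.univ, (fun a W' => c a * linkDeriv e (B.T a) f W') a W :=
    funext fun W => linkDeriv_sum_smul (hf.differentiable (by simp) W) e c B.T
  rw [h, linkDeriv_finset_sum e X Finset.univ _
    (fun a _ => contDiff_const.mul (contDiff_linkDeriv hf e (B.T a)))]
  exact Finset.sum_congr rfl fun a _ => linkDeriv_const_mul' e X (c a) _ W

/-- **The link Laplacian does not depend on the basis**: `Δ_B f = Δ_{B'} f` for smooth `f`
("coincides with the colour-electric part of the Hamilton operator" — an intrinsic operator).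
[cite: Luscher2010Trivializing, §4.2 eq. (4.6), App. A.1 (after eq. (A.2))] -/
theorem linkLap_suBasis_eq (B B' : SuBasis n) {f : AmbConfig d L n → ℝ} (hf : ContDiff ℝ ∞ f) :
    linkLap B f = linkLap B' f := by
  funext W
  unfold linkLap
  refine congrArg Neg.neg (Finset.sum_congr rfl fun e _ => ?_)
  refine sum_suBasis_eq B B' (fun X Y => linkDeriv e X (linkDeriv e Y f) W) ?_ ?_
  · intro c Y
    exact linkDeriv_sum_smul ((contDiff_linkDeriv hf e Y).differentiable (by simp) W) e c B'.T
  · intro X c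
    exact linkDeriv_linkDeriv_sum_smul B hf e X c W

end Summit.Ventures.LatticeQCDFlow.TrivializingMaps
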